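import Mathlib
import Summits.MatrixMultiplication.MatrixMultiplication.Theorems.SnSubsetDichotomyThresholdSubsetTriplesChainDefs

/-!
# `SnSubsetDichotomy.ThresholdSubsetTriples`, line `interleaved-subsignature-ascent` — stub `stub_card`

Registered stub `stub_card` of crux `stmt-MatrixMultiplication-10882` (line
`interleaved-subsignature-ascent`): the sub-signature (chain) class `subsig D` of a direction system
`D : Fin n → Finset (Fin n)` (`d ≤ k` for `d ∈ D k`) has EXACTLY `∏ k, |D k|` elements — unique
factorisation along the point-stabiliser chain (Fisher–Yates / Sims normal form, folklore).

Proof: induction on the level `m ≤ n` for `subsigBelow D m` (`card_subsigBelow`).  The step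
`subsigBelow D (m+1) = P_m * subsigBelow D m` (`subsigBelow_succ_of_lt`, `P_m` the star piece of
level `m`) is a DIRECT pointwise product (`Finset.card_mul_iff`): every word `τ` on the levels `< m`
fixes the point `m` (`subsigBelow_apply_of_le`), so `swap(d,m) · τ = swap(d',m) · τ'` evaluated at
`m` gives `d = d'`, and then `τ = τ'` by cancellation; finally `|P_m| = |D m|` (`card_starPiece`).
-/

-- `Summit.<Summit>.<Problem>` is the tree's mandated summit-side namespace; for this
-- single-conjunct summit the two coincide, so the file silences `dupNamespace`.
set_option linter.dupNamespace false
set_option autoImplicit false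

namespace Summit.MatrixMultiplication.MatrixMultiplication.Theorems.ThresholdSubsetTriples

open scoped Pointwise

section Helpers

variable {n : ℕ}

/-- The product `P_m * L` of the star piece of level `m` with any finite set `L` of permutations
fixing the point `m` is direct: `|P_m * L| = |P_m| * |L|` (evaluate `swap(d,m) · τ` at `m` to read
off `d`, then cancel). -/
theorem card_starPiece_mul_of_apply_eq (E : Finset (Fin n)) (t : Fin n)
    (L : Finset (Equiv.Perm (Fin n))) (hL : ∀ τ ∈ L, τ t = t) :
    (starPiece E t * L).card = (starPiece E t).card * L.card := by
  rw [Finset.card_mul_iff]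
  rintro ⟨x, τ⟩ hx ⟨x', τ'⟩ hx' hxτ
  simp only [Set.mem_prod, Finset.mem_coe] at hx hx'
  simp only at hxτ
  -- `hxτ : x * τ = x' * τ'`
  obtain ⟨e, -, rfl⟩ := mem_starPiece.1 hx.1
  obtain ⟨e', -, rfl⟩ := mem_starPiece.1 hx'.1
  have hτ : τ t = t := hL τ hx.2
  have hτ' : τ' t = t := hL τ' hx'.2
  have hee' : e = e' := by
    have h := congrArg (fun σ : Equiv.Perm (Fin n) => σ t) hxτ
    simpa [Equiv.Perm.mul_apply, hτ, hτ', Equiv.swap_apply_right] using h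
  subst hee'
  have hττ' : τ = τ' := mul_left_cancel hxτ
  subst hττ'
  rfl

/-- Size of the lower chain classes: for `m ≤ n`, the words on the levels `< m` of a direction system
number exactly `∏_{k < m} |D k|` (induction on `m`, the step being `card_starPiece_mul_of_apply_eq`
with `subsigBelow_apply_of_le`). -/
theorem card_subsigBelow (D : Fin n → Finset (Fin n)) (hD : IsDirectionSystem D) :
    ∀ (m : ℕ) (hm : m ≤ n), (subsigBelow D m).card = ∏ i : Fin m, (D (Fin.castLE hm i)).card := by
  intro m
  induction m with
  | zero =>
    intro _
    rw [subsigBelow_zero, Finset.card_singleton, Fin.prod_univ_zero]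
  | succ m ih =>
    intro hm
    have h : m < n := hm
    rw [subsigBelow_succ_of_lt D h, Fin.prod_univ_castSucc]
    have e1 : Fin.castLE hm (Fin.last m) = ⟨m, h⟩ := rfl
    have e2 : (∏ i : Fin m, (D (Fin.castLE hm (Fin.castSucc i))).card)
        = ∏ i : Fin m, (D (Fin.castLE h.le i)).card := rfl
    rw [e1, e2, ← ih h.le, mul_comm (subsigBelow D m).card, ← card_starPiece (D ⟨m, h⟩) ⟨m, h⟩]
    exact card_starPiece_mul_of_apply_eq (D ⟨m, h⟩) ⟨m, h⟩ (subsigBelow D m)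
      (fun τ hτ => subsigBelow_apply_of_le D hD m τ hτ ⟨m, h⟩ le_rfl)

end Helpers

/-- **Stub `stub_card` (exact size of a sub-signature class).**  For a direction system `D` on `n`
points (`d ≤ k` for every `d ∈ D k`), the chain class `subsig D = P_{n-1} ⋯ P_1 P_0`,
`P_k = {swap d k : d ∈ D k}`, has exactly `∏ k, |D k|` elements: the factorisation of a word along
the point-stabiliser chain is unique (Fisher–Yates / Sims normal form).
[folklore: unique factorisation along a point-stabiliser chain (Sims 1970)] -/
theorem stub_card {n : ℕ} (D : Fin n → Finset (Fin n)) (hD : IsDirectionSystem D) :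
    (subsig D).card = ∏ k, (D k).card := by
  rw [subsig_eq, card_subsigBelow D hD n le_rfl]
  rfl

end Summit.MatrixMultiplication.MatrixMultiplication.Theorems.ThresholdSubsetTriples
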